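import Mathlib
import HarnessLib
import Summits.ValiantsHypothesis.ValiantsHypothesis.Theorems.LacunarySymmetroidMatrixDescartesCensusCertificates
import Summits.ValiantsHypothesis.ValiantsHypothesis.Theorems.LacunarySymmetroidMatrixDescartesOsculationLawTwoKPencil

/-!
# ValiantsHypothesis / LacunarySymmetroid — crux `MatrixDescartes` (stmt-ValiantsHypothesis-18050, V1),
# line «osculation-law», rung O3: rank-three PENCIL BOOKKEEPING on `Fin 3 ⊕ Fin 1` (the `(3,1)` letter as a non-monic cubic in the entry polynomials)

Roster R2664 (b) / R2685 (O3 = val-sym-engine-7; this file engine-7 g5).  Companion of ✓ `…OsculationCensusRankTwoPencil` (g4; `Fin 2 ⊕ Fin 1`,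
`Fin 2 ⊕ Fin 2`).  For a pencil `G(t) = Σ_l t^(d l) S_l` on `Fin 3 ⊕ Fin 1` (indices `inl 0, inl 1, inl 2, inr 0`):
* `det_three_one` — the `4 × 4` Leibniz expansion on `Fin 3 ⊕ Fin 1` (✓ `Census.det_fin_four` after `finSumFinEquiv`);
* `insertionPoly_three_one` — the insertion polynomial `det(G(X₀) + X₁·(I₃ ⊕ 0))` of the line (its `insertionPoly`, `blockProj` unfolded) is the
  NON-MONIC CUBIC `X₁X₁X₁·ι(a₃) + X₁X₁·ι(a₂) + X₁·ι(a₁) + ι(det G)` with `a₃ = G₃₃` (the `1 × 1` lower block), `a₂` = the three `2 × 2` principal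
  minors through the lower index, `a₁` = the three `3 × 3` principal minors through the lower index, all written in the entry polynomials `G i j`
  (`ι : X ↦ X₀`); this is the shape consumed by ✓ `OsculationCuspCubic.eval_Psi3` / `eval_logHessian_Psi3` / ✓ `OsculationRankThree.hess_pseudo_reduce_poly3`.
Used by the `(3,1)` instances of the O3 table (F5 = the `ν(4,3) = 10` extremiser at its four rank-three splittings).

CALIBRATION, NOT LAW.  `m = 4` is covered by `rungFour` / `rungAll`; the LAW `stub_osculationLaw`, the crux `MatrixDescartes`, Conjecture B
and `VP ≠ VNP` are OPEN / NOT proved; no summit statement is proved by this file.  No definitions, no named facts.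
-/

-- `Summit.ValiantsHypothesis.ValiantsHypothesis.…` is the tree's mandated single-conjunct layout (Sub = Summit).
set_option linter.dupNamespace false

noncomputable section

namespace Summit.ValiantsHypothesis.ValiantsHypothesis.Theorems.LacunarySymmetroidMatrixDescartes

open Polynomial Matrix Finset
open scoped BigOperators

namespace OsculationCensus

/-- A `4 × 4` determinant on `Fin 3 ⊕ Fin 1` (Leibniz; indices `inl 0, inl 1, inl 2, inr 0`). [folklore] -/
theorem det_three_one {R : Type*} [CommRing R] (N : Matrix (Fin 3 ⊕ Fin 1) (Fin 3 ⊕ Fin 1) R) :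
    N.det =
      N (Sum.inl 0) (Sum.inl 0) * N (Sum.inl 1) (Sum.inl 1) * N (Sum.inl 2) (Sum.inl 2) * N (Sum.inr 0) (Sum.inr 0) - N (Sum.inl 0) (Sum.inl 0) * N (Sum.inl 1) (Sum.inl 1) * N (Sum.inl 2) (Sum.inr 0) * N (Sum.inr 0) (Sum.inl 2)
      - N (Sum.inl 0) (Sum.inl 0) * N (Sum.inl 1) (Sum.inl 2) * N (Sum.inl 2) (Sum.inl 1) * N (Sum.inr 0) (Sum.inr 0) + N (Sum.inl 0) (Sum.inl 0) * N (Sum.inl 1) (Sum.inl 2) * N (Sum.inl 2) (Sum.inr 0) * N (Sum.inr 0) (Sum.inl 1)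
      + N (Sum.inl 0) (Sum.inl 0) * N (Sum.inl 1) (Sum.inr 0) * N (Sum.inl 2) (Sum.inl 1) * N (Sum.inr 0) (Sum.inl 2) - N (Sum.inl 0) (Sum.inl 0) * N (Sum.inl 1) (Sum.inr 0) * N (Sum.inl 2) (Sum.inl 2) * N (Sum.inr 0) (Sum.inl 1)
      - N (Sum.inl 0) (Sum.inl 1) * N (Sum.inl 1) (Sum.inl 0) * N (Sum.inl 2) (Sum.inl 2) * N (Sum.inr 0) (Sum.inr 0) + N (Sum.inl 0) (Sum.inl 1) * N (Sum.inl 1) (Sum.inl 0) * N (Sum.inl 2) (Sum.inr 0) * N (Sum.inr 0) (Sum.inl 2)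
      + N (Sum.inl 0) (Sum.inl 1) * N (Sum.inl 1) (Sum.inl 2) * N (Sum.inl 2) (Sum.inl 0) * N (Sum.inr 0) (Sum.inr 0) - N (Sum.inl 0) (Sum.inl 1) * N (Sum.inl 1) (Sum.inl 2) * N (Sum.inl 2) (Sum.inr 0) * N (Sum.inr 0) (Sum.inl 0)
      - N (Sum.inl 0) (Sum.inl 1) * N (Sum.inl 1) (Sum.inr 0) * N (Sum.inl 2) (Sum.inl 0) * N (Sum.inr 0) (Sum.inl 2) + N (Sum.inl 0) (Sum.inl 1) * N (Sum.inl 1) (Sum.inr 0) * N (Sum.inl 2) (Sum.inl 2) * N (Sum.inr 0) (Sum.inl 0)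
      + N (Sum.inl 0) (Sum.inl 2) * N (Sum.inl 1) (Sum.inl 0) * N (Sum.inl 2) (Sum.inl 1) * N (Sum.inr 0) (Sum.inr 0) - N (Sum.inl 0) (Sum.inl 2) * N (Sum.inl 1) (Sum.inl 0) * N (Sum.inl 2) (Sum.inr 0) * N (Sum.inr 0) (Sum.inl 1)
      - N (Sum.inl 0) (Sum.inl 2) * N (Sum.inl 1) (Sum.inl 1) * N (Sum.inl 2) (Sum.inl 0) * N (Sum.inr 0) (Sum.inr 0) + N (Sum.inl 0) (Sum.inl 2) * N (Sum.inl 1) (Sum.inl 1) * N (Sum.inl 2) (Sum.inr 0) * N (Sum.inr 0) (Sum.inl 0)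
      + N (Sum.inl 0) (Sum.inl 2) * N (Sum.inl 1) (Sum.inr 0) * N (Sum.inl 2) (Sum.inl 0) * N (Sum.inr 0) (Sum.inl 1) - N (Sum.inl 0) (Sum.inl 2) * N (Sum.inl 1) (Sum.inr 0) * N (Sum.inl 2) (Sum.inl 1) * N (Sum.inr 0) (Sum.inl 0)
      - N (Sum.inl 0) (Sum.inr 0) * N (Sum.inl 1) (Sum.inl 0) * N (Sum.inl 2) (Sum.inl 1) * N (Sum.inr 0) (Sum.inl 2) + N (Sum.inl 0) (Sum.inr 0) * N (Sum.inl 1) (Sum.inl 0) * N (Sum.inl 2) (Sum.inl 2) * N (Sum.inr 0) (Sum.inl 1)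
      + N (Sum.inl 0) (Sum.inr 0) * N (Sum.inl 1) (Sum.inl 1) * N (Sum.inl 2) (Sum.inl 0) * N (Sum.inr 0) (Sum.inl 2) - N (Sum.inl 0) (Sum.inr 0) * N (Sum.inl 1) (Sum.inl 1) * N (Sum.inl 2) (Sum.inl 2) * N (Sum.inr 0) (Sum.inl 0)
      - N (Sum.inl 0) (Sum.inr 0) * N (Sum.inl 1) (Sum.inl 2) * N (Sum.inl 2) (Sum.inl 0) * N (Sum.inr 0) (Sum.inl 1) + N (Sum.inl 0) (Sum.inr 0) * N (Sum.inl 1) (Sum.inl 2) * N (Sum.inl 2) (Sum.inl 1) * N (Sum.inr 0) (Sum.inl 0) := by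
  rw [← Matrix.det_reindex_self (finSumFinEquiv (m := 3) (n := 1)) N, Census.det_fin_four]
  have h0 : (finSumFinEquiv (m := 3) (n := 1)).symm 0 = Sum.inl 0 := by decide
  have h1 : (finSumFinEquiv (m := 3) (n := 1)).symm 1 = Sum.inl 1 := by decide
  have h2 : (finSumFinEquiv (m := 3) (n := 1)).symm 2 = Sum.inl 2 := by decide
  have h3 : (finSumFinEquiv (m := 3) (n := 1)).symm 3 = Sum.inr 0 := by decide
  simp only [Matrix.reindex_apply, Matrix.submatrix_apply, h0, h1, h2, h3]

set_option maxHeartbeats 1600000 in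
/-- **At `(3,1)` the insertion polynomial is the non-monic cubic** `X₁X₁X₁·ι(G₃₃) + X₁X₁·ι(a₂) + X₁·ι(a₁) + ι(det G)` with `a₂`, `a₁` the
sums of the `2 × 2` resp. `3 × 3` principal minors of `G` through the lower index, in the entry polynomials. [folklore] -/
theorem insertionPoly_three_one {K : ℕ} (d : Fin K → ℕ) (S : Fin K → Matrix (Fin 3 ⊕ Fin 1) (Fin 3 ⊕ Fin 1) ℝ) :
    (∑ l, (MvPolynomial.X (0 : Fin 2) : MvPolynomial (Fin 2) ℝ) ^ d l •
              (S l).map (MvPolynomial.C : ℝ →+* MvPolynomial (Fin 2) ℝ)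
            + (MvPolynomial.X (1 : Fin 2) : MvPolynomial (Fin 2) ℝ) •
              (Matrix.fromBlocks 1 0 0 0 : Matrix (Fin 3 ⊕ Fin 1) (Fin 3 ⊕ Fin 1) ℝ).map
                (MvPolynomial.C : ℝ →+* MvPolynomial (Fin 2) ℝ)).det =
      MvPolynomial.X 1 * MvPolynomial.X 1 * MvPolynomial.X 1 * Polynomial.aeval (MvPolynomial.X 0 : MvPolynomial (Fin 2) ℝ) ((∑ l, (X : ℝ[X]) ^ d l • (S l).map Polynomial.C) (Sum.inr 0) (Sum.inr 0))
        + MvPolynomial.X 1 * MvPolynomial.X 1 * Polynomial.aeval (MvPolynomial.X 0 : MvPolynomial (Fin 2) ℝ)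
          (((∑ l, (X : ℝ[X]) ^ d l • (S l).map Polynomial.C) (Sum.inl 0) (Sum.inl 0) * (∑ l, (X : ℝ[X]) ^ d l • (S l).map Polynomial.C) (Sum.inr 0) (Sum.inr 0) - (∑ l, (X : ℝ[X]) ^ d l • (S l).map Polynomial.C) (Sum.inl 0) (Sum.inr 0) * (∑ l, (X : ℝ[X]) ^ d l • (S l).map Polynomial.C) (Sum.inr 0) (Sum.inl 0))
            + ((∑ l, (X : ℝ[X]) ^ d l • (S l).map Polynomial.C) (Sum.inl 1) (Sum.inl 1) * (∑ l, (X : ℝ[X]) ^ d l • (S l).map Polynomial.C) (Sum.inr 0) (Sum.inr 0) - (∑ l, (X : ℝ[X]) ^ d l • (S l).map Polynomial.C) (Sum.inl 1) (Sum.inr 0) * (∑ l, (X : ℝ[X]) ^ d l • (S l).map Polynomial.C) (Sum.inr 0) (Sum.inl 1))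
            + ((∑ l, (X : ℝ[X]) ^ d l • (S l).map Polynomial.C) (Sum.inl 2) (Sum.inl 2) * (∑ l, (X : ℝ[X]) ^ d l • (S l).map Polynomial.C) (Sum.inr 0) (Sum.inr 0) - (∑ l, (X : ℝ[X]) ^ d l • (S l).map Polynomial.C) (Sum.inl 2) (Sum.inr 0) * (∑ l, (X : ℝ[X]) ^ d l • (S l).map Polynomial.C) (Sum.inr 0) (Sum.inl 2)))
        + MvPolynomial.X 1 * Polynomial.aeval (MvPolynomial.X 0 : MvPolynomial (Fin 2) ℝ)
          (((∑ l, (X : ℝ[X]) ^ d l • (S l).map Polynomial.C) (Sum.inl 1) (Sum.inl 1) * (∑ l, (X : ℝ[X]) ^ d l • (S l).map Polynomial.C) (Sum.inl 2) (Sum.inl 2) * (∑ l, (X : ℝ[X]) ^ d l • (S l).map Polynomial.C) (Sum.inr 0) (Sum.inr 0) - (∑ l, (X : ℝ[X]) ^ d l • (S l).map Polynomial.C) (Sum.inl 1) (Sum.inl 1) * (∑ l, (X : ℝ[X]) ^ d l • (S l).map Polynomial.C) (Sum.inl 2) (Sum.inr 0) * (∑ l, (X : ℝ[X]) ^ d l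 • (S l).map Polynomial.C) (Sum.inr 0) (Sum.inl 2)
            - (∑ l, (X : ℝ[X]) ^ d l • (S l).map Polynomial.C) (Sum.inl 1) (Sum.inl 2) * (∑ l, (X : ℝ[X]) ^ d l • (S l).map Polynomial.C) (Sum.inl 2) (Sum.inl 1) * (∑ l, (X : ℝ[X]) ^ d l • (S l).map Polynomial.C) (Sum.inr 0) (Sum.inr 0) + (∑ l, (X : ℝ[X]) ^ d l • (S l).map Polynomial.C) (Sum.inl 1) (Sum.inl 2) * (∑ l, (X : ℝ[X]) ^ d l • (S l).map Polynomial.C) (Sum.inl 2) (Sum.inr 0) * (∑ l, (X : ℝ[X]) ^ d l • (S l).map Polynomial.C) (Sum.inr 0) (Sum.inl 1)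
            + (∑ l, (X : ℝ[X]) ^ d l • (S l).map Polynomial.C) (Sum.inl 1) (Sum.inr 0) * (∑ l, (X : ℝ[X]) ^ d l • (S l).map Polynomial.C) (Sum.inl 2) (Sum.inl 1) * (∑ l, (X : ℝ[X]) ^ d l • (S l).map Polynomial.C) (Sum.inr 0) (Sum.inl 2) - (∑ l, (X : ℝ[X]) ^ d l • (S l).map Polynomial.C) (Sum.inl 1) (Sum.inr 0) * (∑ l, (X : ℝ[X]) ^ d l • (S l).map Polynomial.C) (Sum.inl 2) (Sum.inl 2) * (∑ l, (X : ℝ[X]) ^ d l • (S l).map Polynomial.C) (Sum.inr 0) (Sum.inl 1))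
        + ((∑ l, (X : ℝ[X]) ^ d l • (S l).map Polynomial.C) (Sum.inl 0) (Sum.inl 0) * (∑ l, (X : ℝ[X]) ^ d l • (S l).map Polynomial.C) (Sum.inl 2) (Sum.inl 2) * (∑ l, (X : ℝ[X]) ^ d l • (S l).map Polynomial.C) (Sum.inr 0) (Sum.inr 0) - (∑ l, (X : ℝ[X]) ^ d l • (S l).map Polynomial.C) (Sum.inl 0) (Sum.inl 0) * (∑ l, (X : ℝ[X]) ^ d l • (S l).map Polynomial.C) (Sum.inl 2) (Sum.inr 0) * (∑ l, (X : ℝ[X]) ^ d l • (S l).map Polynomial.C) (Sum.inr 0) (Sum.inl 2)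
            - (∑ l, (X : ℝ[X]) ^ d l • (S l).map Polynomial.C) (Sum.inl 0) (Sum.inl 2) * (∑ l, (X : ℝ[X]) ^ d l • (S l).map Polynomial.C) (Sum.inl 2) (Sum.inl 0) * (∑ l, (X : ℝ[X]) ^ d l • (S l).map Polynomial.C) (Sum.inr 0) (Sum.inr 0) + (∑ l, (X : ℝ[X]) ^ d l • (S l).map Polynomial.C) (Sum.inl 0) (Sum.inl 2) * (∑ l, (X : ℝ[X]) ^ d l • (S l).map Polynomial.C) (Sum.inl 2) (Sum.inr 0) * (∑ l, (X : ℝ[X]) ^ d l • (S l).map Polynomial.C) (Sum.inr 0) (Sum.inl 0)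
            + (∑ l, (X : ℝ[X]) ^ d l • (S l).map Polynomial.C) (Sum.inl 0) (Sum.inr 0) * (∑ l, (X : ℝ[X]) ^ d l • (S l).map Polynomial.C) (Sum.inl 2) (Sum.inl 0) * (∑ l, (X : ℝ[X]) ^ d l • (S l).map Polynomial.C) (Sum.inr 0) (Sum.inl 2) - (∑ l, (X : ℝ[X]) ^ d l • (S l).map Polynomial.C) (Sum.inl 0) (Sum.inr 0) * (∑ l, (X : ℝ[X]) ^ d l • (S l).map Polynomial.C) (Sum.inl 2) (Sum.inl 2) * (∑ l, (X : ℝ[X]) ^ d l • (S l).map Polynomial.C) (Sum.inr 0) (Sum.inl 0))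
        + ((∑ l, (X : ℝ[X]) ^ d l • (S l).map Polynomial.C) (Sum.inl 0) (Sum.inl 0) * (∑ l, (X : ℝ[X]) ^ d l • (S l).map Polynomial.C) (Sum.inl 1) (Sum.inl 1) * (∑ l, (X : ℝ[X]) ^ d l • (S l).map Polynomial.C) (Sum.inr 0) (Sum.inr 0) - (∑ l, (X : ℝ[X]) ^ d l • (S l).map Polynomial.C) (Sum.inl 0) (Sum.inl 0) * (∑ l, (X : ℝ[X]) ^ d l • (S l).map Polynomial.C) (Sum.inl 1) (Sum.inr 0) * (∑ l, (X : ℝ[X]) ^ d l • (S l).map Polynomial.C) (Sum.inr 0) (Sum.inl 1)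
            - (∑ l, (X : ℝ[X]) ^ d l • (S l).map Polynomial.C) (Sum.inl 0) (Sum.inl 1) * (∑ l, (X : ℝ[X]) ^ d l • (S l).map Polynomial.C) (Sum.inl 1) (Sum.inl 0) * (∑ l, (X : ℝ[X]) ^ d l • (S l).map Polynomial.C) (Sum.inr 0) (Sum.inr 0) + (∑ l, (X : ℝ[X]) ^ d l • (S l).map Polynomial.C) (Sum.inl 0) (Sum.inl 1) * (∑ l, (X : ℝ[X]) ^ d l • (S l).map Polynomial.C) (Sum.inl 1) (Sum.inr 0) * (∑ l, (X : ℝ[X]) ^ d l • (S l).map Polynomial.C) (Sum.inr 0) (Sum.inl 0)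
            + (∑ l, (X : ℝ[X]) ^ d l • (S l).map Polynomial.C) (Sum.inl 0) (Sum.inr 0) * (∑ l, (X : ℝ[X]) ^ d l • (S l).map Polynomial.C) (Sum.inl 1) (Sum.inl 0) * (∑ l, (X : ℝ[X]) ^ d l • (S l).map Polynomial.C) (Sum.inr 0) (Sum.inl 1) - (∑ l, (X : ℝ[X]) ^ d l • (S l).map Polynomial.C) (Sum.inl 0) (Sum.inr 0) * (∑ l, (X : ℝ[X]) ^ d l • (S l).map Polynomial.C) (Sum.inl 1) (Sum.inl 1) * (∑ l, (X : ℝ[X]) ^ d l • (S l).map Polynomial.C) (Sum.inr 0) (Sum.inl 0)))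
        + Polynomial.aeval (MvPolynomial.X 0 : MvPolynomial (Fin 2) ℝ) (∑ l, (X : ℝ[X]) ^ d l • (S l).map Polynomial.C).det := by
  rw [AlgHom.map_det, AlgHom.mapMatrix_apply, det_three_one, det_three_one, ← OsculationTwoK.map_aevalX0_pencil_gen d S]
  simp only [Matrix.add_apply, Matrix.smul_apply, Matrix.map_apply, Matrix.fromBlocks_apply₁₁,
    Matrix.fromBlocks_apply₁₂, Matrix.fromBlocks_apply₂₁, Matrix.fromBlocks_apply₂₂, Matrix.one_apply_eq,
    Matrix.one_apply_ne (show (0 : Fin 3) ≠ 1 by decide), Matrix.one_apply_ne (show (1 : Fin 3) ≠ 0 by decide),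
    Matrix.one_apply_ne (show (0 : Fin 3) ≠ 2 by decide), Matrix.one_apply_ne (show (2 : Fin 3) ≠ 0 by decide),
    Matrix.one_apply_ne (show (1 : Fin 3) ≠ 2 by decide), Matrix.one_apply_ne (show (2 : Fin 3) ≠ 1 by decide),
    Matrix.zero_apply, smul_eq_mul, map_zero, map_one, mul_one, mul_zero, add_zero, map_add, map_sub, map_mul]
  ring

end OsculationCensus

end Summit.ValiantsHypothesis.ValiantsHypothesis.Theorems.LacunarySymmetroidMatrixDescartes
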